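import Summits.QuantumFields.GaugeBoot.TiltedBoxLimitGeometry
import HarnessLib

/-!
# Infinite-volume limit points of the 45°-tilted boxes, part 3: invariances

HONEST FRAMING (cell `pub-gaugeboot`, page 1 of every file): the venture produces certified bounds
on lattice expectations at stated coupling, gauge group, dimension and torus size; NOT a mass gap,
NOT a continuum limit, NOT a string tension; NOT Yang–Mills-summit-bearing (barriers
`FixedCouplingUltralocality`, `PerturbativeInvisibility`). Structural facts about a class of
infinite-volume Wilson states; nothing else is claimed.

## Content

Every tilted limit point `μ ∈ tiltedBoxLimitPoints d i j ρ β` (`TiltedBoxLimitPoints.lean`: weak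
limits of the Wilson states of the square 45°-tilted boxes `ℤ^d/Γ(M_k + 2, M_k + 2, 2(Q_k + 2))`,
`M_k, Q_k → ∞`; compact second countable `G`, continuous `ρ`, every real `β`, `i ≠ j`) is

* translation invariant (`isZdTranslationInvariant_of_mem_tiltedBoxLimitPoints`) — the boxes are
  quotients of `ℤ^d` by a lattice, so ALL lattice translations act on them and preserve their Wilson
  measure (`TiltedLatticeSymmetry.lean`);
* invariant under the diagonal swap `configDiagSwapZd i j` (= the axis permutation `(i j)`,
  `map_configDiagSwapZd_eq_…`, `measurePreserving_configPerm_swap_…`) — `tiltedBox_integral_comp_configSwap`;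
* invariant under the coordinate reflection `configSiteReflect m` along EVERY axis `m`
  (`reflectInvariant_of_mem_tiltedBoxLimitPoints`) — along `k ∉ {i, j}` by
  `tiltedBox_integral_comp_configReflect_anyPeriod`, along `i`, `j` because the boxes are square
  (`tiltedLattice_le_comap_negHom_left/right`, `tiltedBox_integral_comp_flip`);
* invariant under the link reflection `configLinkReflect k` along every `k ∉ {i, j}`
  (`measurePreserving_configLinkReflect_of_mem_tiltedBoxLimitPoints`) —
  `tiltedBox_integral_comp_configMidReflect` (even transverse period).

Each statement is the limit (`IsTiltedBoxLimitAlong.map_eq_of_eventually`) of the corresponding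
box invariance read through the intertwiners of `TiltedBoxLimitGeometry.lean`. NOT claimed:
invariance under permutations moving `i` or `j` to another axis, or under the in-plane axis/link
mirrors as REFLECTION POSITIVITIES (those fail on every box of the family, `TiltedBoxAxisRPNegative`,
`TiltedBoxEvenMidAxisRPNegative`; as mere symmetries the axis flips along `i`, `j` do hold, above).

References: J. Fröhlich, R. Israel, E. H. Lieb, B. Simon, J. Stat. Phys. 22 (1980) 297, §3;
E. Seiler, LNP 159 (1982) Ch. 2.
-/

noncomputable section

open MeasureTheory Filter Topology
open Literature.Probability.LatticeModels (Site)
open Literature.MathematicalPhysics.QuantumLattice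

namespace Summit.QuantumFields.GaugeBoot

namespace TiltedRP

variable {d : ℕ} {i j : Fin d} {N : ℕ}
variable {G : Type*} [Group G] [TopologicalSpace G] [IsTopologicalGroup G] [CompactSpace G]
  [MeasurableSpace G] [BorelSpace G] [SecondCountableTopology G]
variable (ρ : G →* Matrix (Fin N) (Fin N) ℂ)

/-! ## Box steps: invariance of the lifted expectations -/

section BoxSteps

variable {Mu Mv L : ℕ} [NeZero Mu] [NeZero Mv] [NeZero L]

/-- **Translations**: `∫ F(configShift v (tiltedLift U)) dμ_β = ∫ F(tiltedLift U) dμ_β` on every box. -/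
theorem integral_comp_configShift_tiltedLift (hρ : Continuous ρ) (β : ℝ) (v : Site d)
    {F : LGConfig d G → ℝ} (hFm : Measurable F) :
    ∫ U, F (configShift v (tiltedLift d i j Mu Mv L U)) ∂(gibbs ρ (tiltedUnit d i j Mu Mv L) β) =
      ∫ U, F (tiltedLift d i j Mu Mv L U) ∂(gibbs ρ (tiltedUnit d i j Mu Mv L) β) := by
  have h : ∀ U : Config (TiltedSite d i j Mu Mv L) d G, configShift v (tiltedLift d i j Mu Mv L U) =
      tiltedLift d i j Mu Mv L (translate ((-v : Site d) : TiltedSite d i j Mu Mv L) U) := by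
    intro U
    rw [tiltedLift_translate, neg_neg]
  simp_rw [h]
  exact integral_comp_translate_gibbs ρ hρ _ β _ (hFm.comp (measurable_tiltedLift d i j Mu Mv L))

/-- **The diagonal mirror** (`i ≠ j`, `M_v ≥ 2`):
`∫ F(configDiagSwapZd i j (tiltedLift U)) dμ_β = ∫ F(tiltedLift U) dμ_β`. -/
theorem integral_comp_configDiagSwapZd_tiltedLift (hij : i ≠ j) (hMv : 2 ≤ Mv) (hρ : Continuous ρ)
    (β : ℝ) {F : LGConfig d G → ℝ} (hFm : Measurable F) :
    ∫ U, F (configDiagSwapZd i j (tiltedLift d i j Mu Mv L U)) ∂(gibbs ρ (tiltedUnit d i j Mu Mv L) β) =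
      ∫ U, F (tiltedLift d i j Mu Mv L U) ∂(gibbs ρ (tiltedUnit d i j Mu Mv L) β) := by
  simp_rw [← tiltedLift_configSwap]
  exact tiltedBox_integral_comp_configSwap ρ hij hMv hρ β
    (hFm.comp (measurable_tiltedLift d i j Mu Mv L))

/-- **The link reflection along `k ∉ {i, j}`** (transverse period `2Q`, `Q ≥ 2`):
`∫ F(configLinkReflect k (tiltedLift U)) dμ_β = ∫ F(tiltedLift U) dμ_β`. -/
theorem integral_comp_configLinkReflect_tiltedLift {Q : ℕ} [NeZero Q] {k : Fin d} (hki : k ≠ i)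
    (hkj : k ≠ j) (hQ : 2 ≤ Q) (hρ : Continuous ρ) (β : ℝ) {F : LGConfig d G → ℝ}
    (hFm : Measurable F) :
    ∫ U, F (configLinkReflect k (tiltedLift d i j Mu Mv (2 * Q) U))
        ∂(gibbs ρ (tiltedUnit d i j Mu Mv (2 * Q)) β) =
      ∫ U, F (tiltedLift d i j Mu Mv (2 * Q) U) ∂(gibbs ρ (tiltedUnit d i j Mu Mv (2 * Q)) β) := by
  simp_rw [← tiltedLift_configMidReflect d i j Mu Mv (2 * Q) hki hkj]
  exact tiltedBox_integral_comp_configMidReflect ρ hki hkj hQ hρ β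
    (hFm.comp (measurable_tiltedLift d i j Mu Mv (2 * Q)))

end BoxSteps

/-- `Γ` of the SQUARE box is flip invariant along every axis. -/
theorem tiltedLattice_le_comap_negHom_square (hij : i ≠ j) (M L : ℕ) (m : Fin d) :
    tiltedLattice d i j M M L ≤ (tiltedLattice d i j M M L).comap (negHom d m) := by
  by_cases hmi : m = i
  · subst hmi; exact tiltedLattice_le_comap_negHom_left d L hij
  by_cases hmj : m = j
  · subst hmj; exact tiltedLattice_le_comap_negHom_right d L hij
  exact tiltedLattice_le_comap_negHom d M M L hmi hmj

/-- **The coordinate reflection along every axis `m`** (square box, `i ≠ j`):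
`∫ F(configSiteReflect m (tiltedLift U)) dμ_β = ∫ F(tiltedLift U) dμ_β`. -/
theorem integral_comp_configSiteReflect_tiltedLift {M L : ℕ} [NeZero M] [NeZero L] (hij : i ≠ j)
    (m : Fin d) (hρ : Continuous ρ) (β : ℝ) {F : LGConfig d G → ℝ} (hFm : Measurable F) :
    ∫ U, F (configSiteReflect m (tiltedLift d i j M M L U)) ∂(gibbs ρ (tiltedUnit d i j M M L) β) =
      ∫ U, F (tiltedLift d i j M M L U) ∂(gibbs ρ (tiltedUnit d i j M M L) β) := by
  have hΓ := tiltedLattice_le_comap_negHom_square hij M L m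
  simp_rw [← tiltedLift_configReflect_flip d i j M M L m hΓ]
  exact tiltedBox_integral_comp_flip ρ m hΓ hρ β (hFm.comp (measurable_tiltedLift d i j M M L))

/-! ## Invariances of the limit points -/

section Limit

variable [T2Space G]

/-- **Every tilted limit point is translation invariant.** -/
theorem isZdTranslationInvariant_of_mem_tiltedBoxLimitPoints (hρ : Continuous ρ) {β : ℝ}
    {μ : Measure (LGConfig d G)} (hμ : μ ∈ tiltedBoxLimitPoints d i j ρ β) :
    IsZdTranslationInvariant μ := by
  intro v
  obtain ⟨M, Q, -, -, h⟩ := hμ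
  exact h.map_eq_of_eventually (configShift v).measurable
    (Literature.MathematicalPhysics.QuantumFieldTheory.continuous_configShift v)
    (fun F S hFS =>
      ⟨_, Literature.MathematicalPhysics.QuantumFieldTheory.IsCylinder.comp_configShift hFS v⟩)
    fun F S _ hFc _ => Eventually.of_forall fun k =>
      integral_comp_configShift_tiltedLift ρ hρ β v hFc.measurable

/-- **Every tilted limit point is invariant under the diagonal swap `(i j)`** (`i ≠ j`). -/
theorem map_configDiagSwapZd_eq_of_mem_tiltedBoxLimitPoints (hij : i ≠ j) (hρ : Continuous ρ)
    {β : ℝ} {μ : Measure (LGConfig d G)} (hμ : μ ∈ tiltedBoxLimitPoints d i j ρ β) :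
    μ.map (configDiagSwapZd i j) = μ := by
  obtain ⟨M, Q, -, -, h⟩ := hμ
  exact h.map_eq_of_eventually DiagRP.measurable_configDiagSwapZd (continuous_configDiagSwapZd i j)
    (fun F S hFS => ⟨_, isCylinder_comp_configDiagSwapZd hFS i j⟩)
    fun F S _ hFc _ => Eventually.of_forall fun k =>
      integral_comp_configDiagSwapZd_tiltedLift ρ hij (by omega) hρ β hFc.measurable

/-- The diagonal swap preserves every tilted limit point. -/
theorem measurePreserving_configDiagSwapZd_of_mem_tiltedBoxLimitPoints (hij : i ≠ j)
    (hρ : Continuous ρ) {β : ℝ} {μ : Measure (LGConfig d G)}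
    (hμ : μ ∈ tiltedBoxLimitPoints d i j ρ β) :
    MeasurePreserving (configDiagSwapZd (G := G) i j) μ μ :=
  ⟨DiagRP.measurable_configDiagSwapZd, map_configDiagSwapZd_eq_of_mem_tiltedBoxLimitPoints ρ hij hρ hμ⟩

/-- **Axis-permutation invariance for the transposition `(i j)`** (the `permInvariant` field of
`ClassBState` restricted to the swap of the two tilted axes). -/
theorem measurePreserving_configPerm_swap_of_mem_tiltedBoxLimitPoints (hij : i ≠ j)
    (hρ : Continuous ρ) {β : ℝ} {μ : Measure (LGConfig d G)}
    (hμ : μ ∈ tiltedBoxLimitPoints d i j ρ β) :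
    MeasurePreserving (configPerm (G := G) (Equiv.swap i j)) μ μ := by
  rw [← configDiagSwapZd_eq_configPerm_swap]
  exact measurePreserving_configDiagSwapZd_of_mem_tiltedBoxLimitPoints ρ hij hρ hμ

/-- **Every tilted limit point is invariant under the coordinate reflection along every axis.** -/
theorem map_configSiteReflect_eq_of_mem_tiltedBoxLimitPoints (hij : i ≠ j) (hρ : Continuous ρ)
    {β : ℝ} {μ : Measure (LGConfig d G)} (hμ : μ ∈ tiltedBoxLimitPoints d i j ρ β) (m : Fin d) :
    μ.map (configSiteReflect m) = μ := by
  obtain ⟨M, Q, -, -, h⟩ := hμ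
  exact h.map_eq_of_eventually (measurable_configSiteReflect m) (continuous_configSiteReflect m)
    (fun F S hFS => ⟨_, isCylinder_comp_configSiteReflect hFS m⟩)
    fun F S _ hFc _ => Eventually.of_forall fun k =>
      integral_comp_configSiteReflect_tiltedLift ρ hij m hρ β hFc.measurable

/-- The `reflectInvariant` field of `ClassBState` for tilted limit points: every coordinate
reflection preserves `μ`. -/
theorem reflectInvariant_of_mem_tiltedBoxLimitPoints (hij : i ≠ j) (hρ : Continuous ρ) {β : ℝ}
    {μ : Measure (LGConfig d G)} (hμ : μ ∈ tiltedBoxLimitPoints d i j ρ β) (m : Fin d) :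
    MeasurePreserving (configSiteReflect (G := G) m) μ μ :=
  ⟨measurable_configSiteReflect m, map_configSiteReflect_eq_of_mem_tiltedBoxLimitPoints ρ hij hρ hμ m⟩

/-- **Every tilted limit point is invariant under the link reflection along `k ∉ {i, j}`.** -/
theorem map_configLinkReflect_eq_of_mem_tiltedBoxLimitPoints {k : Fin d} (hki : k ≠ i) (hkj : k ≠ j)
    (hρ : Continuous ρ) {β : ℝ} {μ : Measure (LGConfig d G)}
    (hμ : μ ∈ tiltedBoxLimitPoints d i j ρ β) :
    μ.map (configLinkReflect k) = μ := by
  obtain ⟨M, Q, -, -, h⟩ := hμ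
  exact h.map_eq_of_eventually (measurable_configLinkReflect k) (continuous_configLinkReflect k)
    (fun F S hFS => ⟨_, isCylinder_comp_configLinkReflect hFS k⟩)
    fun F S _ hFc _ => Eventually.of_forall fun n =>
      integral_comp_configLinkReflect_tiltedLift ρ hki hkj (by omega) hρ β hFc.measurable

/-- The link reflection along `k ∉ {i, j}` preserves every tilted limit point. -/
theorem measurePreserving_configLinkReflect_of_mem_tiltedBoxLimitPoints {k : Fin d} (hki : k ≠ i)
    (hkj : k ≠ j) (hρ : Continuous ρ) {β : ℝ} {μ : Measure (LGConfig d G)}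
    (hμ : μ ∈ tiltedBoxLimitPoints d i j ρ β) :
    MeasurePreserving (configLinkReflect (G := G) k) μ μ :=
  ⟨measurable_configLinkReflect k, map_configLinkReflect_eq_of_mem_tiltedBoxLimitPoints ρ hki hkj hρ hμ⟩

end Limit

end TiltedRP

end Summit.QuantumFields.GaugeBoot
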